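import Mathlib
import Summits.ResolutionOfSingularities.ResolutionOfSingularities.Theorems.RadicialJungCleanModelsCleanPointBlowupChartFormOne
import Summits.ResolutionOfSingularities.ResolutionOfSingularities.Theorems.RadicialJungCleanModelsStubExtendParameter
import Literature.AlgebraicGeometry.Resolution.BlowupStalkCharts
import Literature.AlgebraicGeometry.Resolution.PermissibleCentres
import Literature.AlgebraicGeometry.Resolution.RegularSystemOfParameters
import Literature.AlgebraicGeometry.Motives.CartierDivisor
import HarnessLib

/-!
# Route `RadicialJung`, crux `CleanModels` (stmt-ResolutionOfSingularities-15917), line `Sketch` rev 14: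
# STUB 4d `stub_cleanPointBlowup` — CLEANNESS SURVIVES CLOSED-POINT BLOW-UPS

Registered stub 4d of `Cruxes/CleanModels/Lines/Sketch.lean` rev 14 (lead res-B-lead-1 g1; brief
`Cruxes/CleanModels/Lines/Sketch-brief-stub_cleanPointBlowup.md`): Piltant 2013, Axiom 2 (ii) at CLOSED points for the
regularity property `P_clean(g₀)` (`CleanRegAt`, `RadicialJungCleanModelsCleanPatchingDefs.lean`), in every dimension: if
the `K^p`-line of `G` is clean-regular at a closed point `s` of an integral Noetherian scheme `S` (function field of
characteristic `p`), it is clean-regular at every point `s'` over `s` of the blow-up `S' → S` of `S` at `s` (`IsBlowup` along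
the reduced ideal `𝓘_{s}`; `s'` need not be closed).  PROVED:

* `cleanRegAt_of_pointBlowupCharts` — the local-algebra form: for a regular local ring `R` read in `F`, a local ring `L` read
  in `F'`, compatible `ψ : R → L`, `ι : F → F'`, and `L` a localisation of a Rees chart of `Bl_𝔪 Spec R` at a prime over `𝔪`
  for every generating family of `𝔪` (the output format of `IsBlowup.exists_reesChart_stalk`), `CleanRegAt p f G` implies
  `CleanRegAt p f' (ι G)`: `L` is regular (`isRegularLocalRing_chart` of `BlowupChartRsop.lean`); forms (1)/(2) by
  `looseCleanForm_reesChart_of_form_one` / `_two` (`RadicialJungCleanModelsCleanPointBlowupChartFormOne.lean`), form (3) by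
  shifting the representative to the regular parameter `s - c^p` (`stub_extendParameter`), and the twisted
  `e^p ι(X) - dd^p` is again a non-trivial representative (`exists_rep_twist`);
* `stub_cleanPointBlowup` — the registered signature, from `IsBlowup.exists_reesChart_stalk` (`BlowupStalkCharts.lean`),
  `stalkIdeal_vanishingIdeal_singleton` (`(𝓘_{s})_s = 𝔪_s`) and `RatFn.functionFieldMap_toFunctionField`.

Honest framing: this is one dimension-free survival lemma (hypothesis `hT2` of the research stub 4e
`stub_cleanPrincipalization3`); nothing here proves resolution in characteristic `p` or any case of `CleanModels`.
-/

noncomputable section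

set_option linter.dupNamespace false -- mandated namespace of this single-conjunct summit

open IsLocalRing MvPolynomial
open Literature.AlgebraicGeometry.Resolution

namespace Summit.ResolutionOfSingularities.ResolutionOfSingularities.Theorems.RadicialJung.CleanModels

universe u

/-! ## Clean-regularity ascends to the points of the blowing up of the closed point -/

/-- **`P_clean` ascends along a point blow-up, local-algebra form.**  Let `R` be a local ring read in a field `F` of
characteristic `p` by an injective `f`, `L` a local ring read in `F'` by an injective `f'`, `ψ : R → L` and `ι : F → F'`
compatible, and suppose that for EVERY generating family `t` of `𝔪_R` the ring `L` is a localisation, at a prime over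
`𝔪_R`, of some chart `(R[𝔪t])_{(t_j t)}` of the blowing up of `Spec R` at its closed point, compatibly with `ψ` (the
output of `IsBlowup.exists_reesChart_stalk`).  If the line of `G` is clean-regular at `R`, then the line of `ι G` is
clean-regular at `L`.  Proof: `L` is regular (`isRegularLocalRing_chart`); a loosely clean representative
`X = Σ c_j^p G^j` at `R` becomes `e^p ι(X) - dd^p` loosely clean at `L` (`e ≠ 0`) — form (1) by
`looseCleanForm_chart_of_form_one`, form (2) by `looseCleanForm_chart_of_form_two`, form (3) `X = f s`,
`s - c^p ∈ 𝔪 ∖ 𝔪²` by shifting the representative to the regular parameter `s - c^p` (form (1) with `m = 1`,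
`stub_extendParameter`) — and `e^p ι(X) - dd^p` is again a non-trivial representative of the line of `ι G`
(`exists_rep_twist`). [cite: Piltant2013, §2 Axiom 2 (ii)] -/
theorem cleanRegAt_of_pointBlowupCharts {R : Type u} [CommRing R] [IsLocalRing R] {L : Type u} [CommRing L]
    [IsLocalRing L] {F F' : Type u} [Field F] [Field F'] (p : ℕ) [hp : Fact p.Prime] [CharP F p] [CharP F' p]
    (f : R →+* F) (hf : Function.Injective f) (f' : L →+* F') (hf' : Function.Injective f')
    (ψ : R →+* L) (ι : F →+* F') (hcomm : ∀ a, ι (f a) = f' (ψ a))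
    (hchart : ∀ (d : ℕ) (t : Fin d → R), Ideal.span (Set.range t) = maximalIdeal R →
      ∃ (j : Fin d) (𝔴 : PrimeSpectrum (chartRing t j)) (χ : chartRing t j →+* L),
        (∀ a, χ (chartBase t j a) = ψ a) ∧
        @IsLocalization.AtPrime _ _ L _ χ.toAlgebra 𝔴.asIdeal _ ∧
        𝔴.asIdeal.comap (chartBase t j) = maximalIdeal R)
    {G : F} (h : CleanRegAt p f G) : CleanRegAt p f' (ι G) := by
  classical
  obtain ⟨hreg, c, hc, hform⟩ := h
  haveI : CharP R p := f.charP hf p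
  have hpd : ∀ {d : ℕ} (t : Fin d → R), Ideal.span (Set.range t) = maximalIdeal R →
      (maximalIdeal R).spanFinrank = d → ringKrullDim R = (d : WithBot ℕ∞) := by
    intro d t _ hd
    rw [← IsRegularLocalRing.spanFinrank_maximalIdeal (R := R), hd]
  -- `L` is a regular local ring: read it on the chart of any regular system of parameters
  have hLreg : IsRegularLocalRing L := by
    obtain ⟨t₀, ht₀⟩ := exists_regularSystemOfParameters (R := R)
    obtain ⟨j, 𝔴, χ, -, hloc, hcomap⟩ := hchart _ t₀ ht₀
    letI := χ.toAlgebra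
    haveI := hloc
    haveI := isNoetherianRing_blowupChart t₀ j
    exact isRegularLocalRing_chart t₀ j Fin.elim0 (span_range_append_elim0 t₀ ht₀) (spanFinrank_eq_add_zero (hpd t₀ ht₀ rfl))
      L (chartBase t₀ j) (chartGen t₀ j) (reesChartBase_mem_nonZeroDivisors _ _)
      (chartQuotEquiv t₀ j (isQuasiRegular_centre t₀ Fin.elim0 (span_range_append_elim0 t₀ ht₀)
        (spanFinrank_eq_add_zero (hpd t₀ ht₀ rfl)))) (chartQuotMap_C t₀ j) (chartQuotMap_X t₀ j) 𝔴.asIdeal hcomap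
  -- form (1) data at `R` for `Y` ⟹ `e^p ι(Y)` loosely clean at `L` for some `e ≠ 0`
  have form1 : ∀ (Y : F) (d m : ℕ) (hmd : m ≤ d) (t : Fin d → R) (a : Fin m → ℕ) (u : R), IsUnit u →
      Ideal.span (Set.range t) = maximalIdeal R → ringKrullDim R = (d : WithBot ℕ∞) → 0 < m → (∀ i, ¬ p ∣ a i) →
      Y = f (u * ∏ i : Fin m, t (Fin.castLE hmd i) ^ a i) → ∃ e : F', e ≠ 0 ∧ LooseCleanForm p f' (e ^ p * ι Y) := by
    intro Y d m hmd t a u hu hspan hdim hm ha hY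
    obtain ⟨j, 𝔴, χ, hχ, hloc, hcomap⟩ := hchart d t hspan
    refine looseCleanForm_reesChart_of_form_one t j hspan hdim 𝔴.asIdeal hcomap L χ hloc p f' hf' hmd hm a ha hu ?_
    rw [hY, hcomm, ← hχ]
  -- every loosely clean `Y` at `R` becomes `e^p ι(Y) - dd^p` loosely clean at `L`
  have key : ∀ Y : F, LooseCleanForm p f Y →
      ∃ e dd : F', e ≠ 0 ∧ LooseCleanForm p f' (e ^ p * ι Y - dd ^ p) := by
    intro Y hY
    rcases hY with ⟨d, m, hmd, t, a, u, hu, hspan, hdim, hm, ha, hYf⟩ | ⟨u, hu, hYf, hup⟩ | ⟨s, c₁, hYf, h1, h2⟩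
    · obtain ⟨e, he, hclean⟩ := form1 Y d m hmd t a u hu hspan hdim hm ha hYf
      exact ⟨e, 0, he, by rwa [zero_pow hp.out.ne_zero, sub_zero]⟩
    · obtain ⟨t, ht⟩ := exists_regularSystemOfParameters (R := R)
      obtain ⟨j, 𝔴, χ, hχ, hloc, hcomap⟩ := hchart _ t ht
      refine ⟨1, 0, one_ne_zero, ?_⟩
      rw [one_pow, one_mul, zero_pow hp.out.ne_zero, sub_zero]
      refine looseCleanForm_reesChart_of_form_two t j ht (hpd t ht rfl) 𝔴.asIdeal hcomap L χ hloc p f' hu hup ?_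
      rw [hYf, hcomm, ← hχ]
    · -- shift the representative: `Y - f(c₁)^p = f(s - c₁^p)`, a regular parameter = form (1) with `m = 1`
      obtain ⟨d, hd0, t, hspan, hdim, ht0⟩ := stub_extendParameter (s - c₁ ^ p) h1 h2
      have hY1 : Y - f c₁ ^ p = f (1 * ∏ i : Fin 1, t (Fin.castLE (Nat.succ_le_of_lt hd0) i) ^ (fun _ => 1) i) := by
        rw [Fin.prod_univ_one, one_mul, pow_one, hYf, ← map_pow, ← map_sub, ← ht0]
        rfl
      obtain ⟨e, he, hclean⟩ := form1 (Y - f c₁ ^ p) d 1 (Nat.succ_le_of_lt hd0) t (fun _ => 1) 1 isUnit_one hspan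
        hdim Nat.one_pos (fun _ h => hp.out.ne_one (Nat.dvd_one.mp h)) hY1
      refine ⟨e, e * ι (f c₁), he, ?_⟩
      rw [mul_pow, ← map_pow, ← mul_sub, ← map_sub]
      exact hclean
  -- conclude: twist the representative of the line of `ι G`
  obtain ⟨e, dd, he, hclean⟩ := key _ hform
  obtain ⟨j₀, hj₀, hcj₀⟩ := hc
  obtain ⟨c', hc', hsum⟩ := exists_rep_twist p (ι G) (fun j => ι (c j))
    ⟨j₀, hj₀, (map_ne_zero ι).mpr hcj₀⟩ e dd he
  refine ⟨hLreg, c', hc', ?_⟩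
  rw [hsum]
  have hι : (∑ j : Fin p, ι (c j) ^ p * ι G ^ (j : ℕ)) = ι (∑ j : Fin p, c j ^ p * G ^ (j : ℕ)) := by
    simp only [map_sum, map_mul, map_pow]
  rw [hι]
  exact hclean

/-! ## The registered stub -/

open CategoryTheory AlgebraicGeometry Literature.AlgebraicGeometry.Motives in
/-- STUB 4d (OURS, M–L, dimension-free): **CLEANNESS SURVIVES CLOSED-POINT BLOW-UPS** (Piltant 2013 Axiom 2 (ii) at
closed points for `P_clean`, every dimension; res-B-lens-1 g2 ADDENDUM A §3.1): if the line of `G` is clean-regular at a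
closed point `s` of an integral Noetherian scheme `S` (function field of characteristic `p`), it is clean-regular at every
point of the blow-up of `S` at `s` lying over `s`.  Chart computation: form (1) `u ∏ tᵢ^(aᵢ)` becomes
`u' · t₁^(Σaᵢ) ∏_(i ∈ N) tᵢ'^(aᵢ)` (twist by `t₁^(-Σaᵢ)` when `p ∣ Σaᵢ`; if then no coordinate is charged, the unit
`U = u ∏ tᵢ'^(aᵢ)` has `D(U) = a_j U` for the `κ(s)`-derivation `D = t_j' ∂/∂t_j'` of the exceptional chart
`κ(s)[t'] = 𝒪_(S',s')/(t₁)`, so `U - c^p ∉ 𝔪'²` by `stub_leibnizObstruction` ⇒ form (2) or (3)); form (2) `u`, `ū ∉ κ(s)^p`: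
stays (2), or drops to (3) by the same Leibniz argument with a derivation of `κ(s)` not killing `ū`, extended
coefficientwise; form (3) = form (1) with `m = 1` for the shifted representative.  Scheme side: the local rings of the
blowing up are localisations of the Rees charts of `Bl_{𝔪_s} Spec 𝒪_{S,s}` (`IsBlowup.exists_reesChart_stalk`, with
`(𝓘_{s})_s = 𝔪_s`, `stalkIdeal_vanishingIdeal_singleton`), compatibly with `K(S) → K(S')`
(`RatFn.functionFieldMap_toFunctionField`); then `cleanRegAt_of_pointBlowupCharts`. [cite: Piltant2013, §2 Axiom 2 (ii)] -/
theorem stub_cleanPointBlowup :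
    ∀ (p : ℕ), p.Prime → ∀ (S : Scheme.{0}) [IsIntegral S] [IsNoetherian S], CharP S.functionField p →
      ∀ (G : S.functionField) (s : S) (hs : IsClosed ({s} : Set S)),
        CleanRegAt p (algebraMap (S.presheaf.stalk s) S.functionField) G →
      ∀ (S' : Scheme.{0}) (τ : S' ⟶ S) [IsIntegral S'] [IsDominant τ],
        IsBlowup τ (Scheme.IdealSheafData.vanishingIdeal ⟨{s}, hs⟩) →
        ∀ s' : S', τ s' = s →
          CleanRegAt p (algebraMap (S'.presheaf.stalk s') S'.functionField) (RatFn.functionFieldMap τ G) := by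
  intro p hp S _ _ hchar G s hs hG S' τ _ _ hτ s' hs'
  subst hs'
  haveI : Fact p.Prime := ⟨hp⟩
  haveI : CharP S'.functionField p := charP_of_injective_ringHom (RatFn.functionFieldMap τ).injective p
  refine cleanRegAt_of_pointBlowupCharts p (algebraMap (S.presheaf.stalk (τ s')) S.functionField)
    (IsFractionRing.injective _ _) (algebraMap (S'.presheaf.stalk s') S'.functionField) (IsFractionRing.injective _ _)
    (τ.stalkMap s').hom (RatFn.functionFieldMap τ) (fun a => RatFn.functionFieldMap_toFunctionField τ s' a) ?_ hG
  intro d t ht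
  exact hτ.exists_reesChart_stalk s' t (ht.trans (stalkIdeal_vanishingIdeal_singleton hs).symm)

end Summit.ResolutionOfSingularities.ResolutionOfSingularities.Theorems.RadicialJung.CleanModels

end
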